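import Literature.MathematicalPhysics.QuantumManyBody.BoseGasDirichletMonotonicity
import HarnessLib

/-!
# The Bose gas: relabelling invariance and the product of two groups of particles

Topic `Literature/MathematicalPhysics/QuantumManyBody`, third proved layer of the thermodynamic-limit
programme of `BoseGasThermodynamicLimitProofs.lean` (provefact
`Literature.MathematicalPhysics.QuantumManyBody.BoseGas.LSSY2005_e0_periodic_eq_dirichlet`). The
spatial SUBADDITIVITY of the Dirichlet ground-state energy (Ruelle 1969 §3.5: the energy of a big
box is at most the sum of the energies of separated sub-boxes) rests on the tensor product of trial
states of the sub-boxes, symmetrised over the particles. This file provides the two ingredients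
that do not involve the symmetrisation:

* **Relabelling.** `relabelCLM σ : X ↦ X ∘ σ`; the kinetic energy density is covariant
  (`kineticDensity_comp_perm`: `|∇(ψ ∘ (·∘σ))|²(X) = |∇ψ|²(X∘σ)`), the interaction is invariant
  (`interaction_comp_perm`, via `two_mul_interaction`: `2∑_{i<j} = ∑_{i≠j}`), and so is Lebesgue
  measure (`lintegral_comp_perm`).
* **Two groups.** `splitConfig : (ℝ³)^{n₁+n₂} ≃ᵐ (ℝ³)^{n₁} × (ℝ³)^{n₂}` (first `n₁` / last `n₂`
  particles; volume preserving, `lintegral_mul_split`: `∫ F(X₁)G(X₂) dX = ∫F ∫G`), the projections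
  `fstCLM`, `sndCLM`, and the **product wave function** `prodFun ψ₁ ψ₂ (X) = ψ₁(X₁) ψ₂(X₂)`:
  `C¹` (`contDiff_prodFun`), Leibniz rule (`fderiv_prodFun`), kinetic density
  `|∇(ψ₁⊗ψ₂)|² = |∇ψ₁|²|ψ₂|² + |ψ₁|²|∇ψ₂|²` (`kineticDensity_prodFun`), splitting of the
  interaction when no particle of the first group interacts with one of the second
  (`interaction_eq_add_of_cross_eq_zero`), whence the energy density and the ENERGY of the product
  of two non-interacting groups, `𝓔[ψ₁⊗ψ₂] = 𝓔[ψ₁]‖ψ₂‖² + ‖ψ₁‖²𝓔[ψ₂]`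
  (`energyDensity_prodFun`, `lintegral_energyDensity_prodFun`, `lintegral_ennnorm_prodFun_sq`).

## References

* [Ruelle1969] D. Ruelle, *Statistical Mechanics: Rigorous Results*, Benjamin 1969, §3.5 (the
  thermodynamic limit for quantum systems: subadditivity from product states in separated boxes).
* [LSSY2005] E. H. Lieb, R. Seiringer, J. P. Solovej, J. Yngvason, *The Mathematics of the Bose
  Gas and its Condensation*, Birkhäuser 2005 (arXiv:cond-mat/0610117), Ch. 2 (2.1)–(2.2).
-/

noncomputable section

open MeasureTheory Filter Metric
open scoped ENNReal NNReal Topology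

namespace Literature.MathematicalPhysics.QuantumManyBody.BoseGas

/-! ### Relabelling the particles -/

section Perm

variable {N : ℕ}

/-- Relabelling the particles by `σ`: the continuous linear map `X ↦ X ∘ σ` of `(ℝ³)^N`. [folklore] -/
def relabelCLM (σ : Equiv.Perm (Fin N)) : Config N →L[ℝ] Config N :=
  ContinuousLinearMap.pi fun j => ContinuousLinearMap.proj (σ j)

/-- `relabelCLM σ X = X ∘ σ`. [folklore] -/
@[simp]
theorem relabelCLM_apply (σ : Equiv.Perm (Fin N)) (X : Config N) : relabelCLM σ X = X ∘ σ := rfl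

/-- Relabelling maps the coordinate direction `(i, ·)` to `(σ⁻¹ i, ·)`. [folklore] -/
theorem single_comp_perm (σ : Equiv.Perm (Fin N)) (i : Fin N) (w : Space) :
    (Pi.single i w : Config N) ∘ σ = Pi.single (σ.symm i) w := by
  funext j
  simp only [Function.comp_apply, Pi.single_apply, Equiv.eq_symm_apply]

/-- **The kinetic energy density is covariant under relabelling**:
`|∇(ψ ∘ (· ∘ σ))|²(X) = |∇ψ|²(X ∘ σ)`. [folklore] -/
theorem kineticDensity_comp_perm (σ : Equiv.Perm (Fin N)) {ψ : Config N → ℂ}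
    (hψ : Differentiable ℝ ψ) (X : Config N) :
    kineticDensity (fun Y => ψ (Y ∘ σ)) X = kineticDensity ψ (X ∘ σ) := by
  unfold kineticDensity
  have hd : fderiv ℝ (fun Y => ψ (Y ∘ σ)) X = (fderiv ℝ ψ (X ∘ σ)).comp (relabelCLM σ) := by
    have h1 : HasFDerivAt ψ (fderiv ℝ ψ (X ∘ σ)) (relabelCLM σ X) := (hψ _).hasFDerivAt
    exact (h1.comp X (relabelCLM σ).hasFDerivAt).fderiv
  simp only [hd, ContinuousLinearMap.comp_apply, relabelCLM_apply, single_comp_perm]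
  exact Fintype.sum_equiv σ.symm _ _ fun i => rfl

/-- The interaction as half the sum over ORDERED pairs: `2 ∑_{i<j} v = ∑_{i ≠ j} v`. [folklore] -/
theorem two_mul_interaction (v : ℝ → ℝ≥0∞) (X : Config N) :
    2 * interaction v X = ∑ i : Fin N, ∑ j : Fin N with j ≠ i, v (dist (X i) (X j)) := by
  unfold interaction
  have hsymm : ∑ i : Fin N, ∑ j : Fin N with i < j, v (dist (X i) (X j)) =
      ∑ i : Fin N, ∑ j : Fin N with j < i, v (dist (X i) (X j)) := by
    simp only [Finset.sum_filter]
    rw [Finset.sum_comm]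
    refine Finset.sum_congr rfl fun i _ => Finset.sum_congr rfl fun j _ => ?_
    rw [dist_comm]
  have hsplit : ∀ i : Fin N, ∑ j : Fin N with j ≠ i, v (dist (X i) (X j)) =
      (∑ j : Fin N with i < j, v (dist (X i) (X j))) + ∑ j : Fin N with j < i, v (dist (X i) (X j)) := by
    intro i
    simp only [Finset.sum_filter, ← Finset.sum_add_distrib]
    refine Finset.sum_congr rfl fun j _ => ?_
    rcases lt_trichotomy i j with h | h | h
    · simp [h, ne_of_gt h, not_lt_of_gt h]
    · simp [h]
    · simp [h, ne_of_lt h, not_lt_of_gt h]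
  simp only [hsplit, Finset.sum_add_distrib, ← hsymm, two_mul]

/-- **The interaction is invariant under relabelling the particles.** [folklore] -/
theorem interaction_comp_perm (v : ℝ → ℝ≥0∞) (σ : Equiv.Perm (Fin N)) (X : Config N) :
    interaction v (X ∘ σ) = interaction v X := by
  have h2 : (2 : ℝ≥0∞) ≠ 0 := two_ne_zero
  have key : 2 * interaction v (X ∘ σ) = 2 * interaction v X := by
    rw [two_mul_interaction, two_mul_interaction]
    simp only [Function.comp_apply, Finset.sum_filter]
    rw [← Equiv.sum_comp σ (fun i => ∑ j, if j ≠ i then v (dist (X i) (X j)) else 0)]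
    refine Finset.sum_congr rfl fun i _ => ?_
    rw [← Equiv.sum_comp σ (fun j => if j ≠ σ i then v (dist (X (σ i)) (X j)) else 0)]
    refine Finset.sum_congr rfl fun j _ => ?_
    simp only [ne_eq, σ.injective.eq_iff]
  exact (ENNReal.mul_right_inj h2 ENNReal.ofNat_ne_top).1 key

/-- Lebesgue measure on `(ℝ³)^N` is invariant under relabelling: `∫ G(X ∘ σ) dX = ∫ G`. [folklore] -/
theorem lintegral_comp_perm (σ : Equiv.Perm (Fin N)) (G : Config N → ℝ≥0∞) :
    ∫⁻ X : Config N, G (X ∘ σ) = ∫⁻ X, G X := by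
  have hmp := volume_measurePreserving_piCongrLeft (fun _ : Fin N => Space) σ.symm
  have h : ∀ X : Config N,
      (MeasurableEquiv.piCongrLeft (fun _ : Fin N => Space) σ.symm) X = X ∘ σ := by
    intro X
    funext j
    simp [MeasurableEquiv.piCongrLeft, Equiv.piCongrLeft_apply_eq_cast]
  have := hmp.lintegral_comp_emb (MeasurableEquiv.measurableEmbedding _) G
  simpa only [h] using this

end Perm

/-! ### Splitting the configuration of `n₁ + n₂` particles -/

section Split

variable {n₁ n₂ : ℕ}

/-- `(ℝ³)^{n₁+n₂} ≃ᵐ (ℝ³)^{n₁} × (ℝ³)^{n₂}`, `X ↦ (X ∘ castAdd, X ∘ natAdd)` (the first `n₁` and the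
last `n₂` particles). [folklore] -/
def splitConfig (n₁ n₂ : ℕ) : Config (n₁ + n₂) ≃ᵐ Config n₁ × Config n₂ :=
  ((MeasurableEquiv.piCongrLeft (fun _ : Fin (n₁ + n₂) => Space) finSumFinEquiv).symm).trans
    (MeasurableEquiv.sumPiEquivProdPi fun _ : Fin n₁ ⊕ Fin n₂ => Space)

/-- First component of the splitting: the first `n₁` particles. [folklore] -/
@[simp]
theorem splitConfig_apply_fst (X : Config (n₁ + n₂)) (i : Fin n₁) :
    (splitConfig n₁ n₂ X).1 i = X (Fin.castAdd n₂ i) := by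
  simp [splitConfig, MeasurableEquiv.piCongrLeft, Equiv.piCongrLeft_symm_apply,
    MeasurableEquiv.sumPiEquivProdPi]

/-- Second component of the splitting: the last `n₂` particles. [folklore] -/
@[simp]
theorem splitConfig_apply_snd (X : Config (n₁ + n₂)) (i : Fin n₂) :
    (splitConfig n₁ n₂ X).2 i = X (Fin.natAdd n₁ i) := by
  simp [splitConfig, MeasurableEquiv.piCongrLeft, Equiv.piCongrLeft_symm_apply,
    MeasurableEquiv.sumPiEquivProdPi]

/-- First component of the splitting, as a function. [folklore] -/
theorem splitConfig_fst (X : Config (n₁ + n₂)) :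
    (splitConfig n₁ n₂ X).1 = fun i => X (Fin.castAdd n₂ i) :=
  funext (splitConfig_apply_fst X)

/-- Second component of the splitting, as a function. [folklore] -/
theorem splitConfig_snd (X : Config (n₁ + n₂)) :
    (splitConfig n₁ n₂ X).2 = fun i => X (Fin.natAdd n₁ i) :=
  funext (splitConfig_apply_snd X)

/-- The splitting preserves Lebesgue measure. [folklore] -/
theorem volume_preserving_splitConfig (n₁ n₂ : ℕ) :
    MeasurePreserving (splitConfig n₁ n₂) volume (volume.prod volume) :=
  ((volume_measurePreserving_piCongrLeft (fun _ : Fin (n₁ + n₂) => Space) finSumFinEquiv).symm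
    _).trans (volume_measurePreserving_sumPiEquivProdPi fun _ : Fin n₁ ⊕ Fin n₂ => Space)

/-- **Product integrals split**: `∫ F(X ∘ castAdd) G(X ∘ natAdd) dX = (∫ F)(∫ G)`. [folklore] -/
theorem lintegral_mul_split {F : Config n₁ → ℝ≥0∞} {G : Config n₂ → ℝ≥0∞} (hF : Measurable F)
    (hG : Measurable G) :
    ∫⁻ X : Config (n₁ + n₂), F (fun i => X (Fin.castAdd n₂ i)) * G (fun i => X (Fin.natAdd n₁ i)) =
      (∫⁻ Y, F Y) * ∫⁻ Z, G Z := by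
  have hmp := volume_preserving_splitConfig n₁ n₂
  have h := hmp.lintegral_comp_emb (splitConfig n₁ n₂).measurableEmbedding
    (fun p : Config n₁ × Config n₂ => F p.1 * G p.2)
  simp only [splitConfig_fst, splitConfig_snd] at h
  rw [h, lintegral_prod_mul hF.aemeasurable hG.aemeasurable]

end Split

/-! ### The product of two wave functions on complementary groups of particles -/

section Product

variable {n₁ n₂ : ℕ}

/-- The coordinates of the first `n₁` particles, as a continuous linear map. [folklore] -/
def fstCLM (n₁ n₂ : ℕ) : Config (n₁ + n₂) →L[ℝ] Config n₁ :=
  ContinuousLinearMap.pi fun i => ContinuousLinearMap.proj (Fin.castAdd n₂ i)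

/-- The coordinates of the last `n₂` particles, as a continuous linear map. [folklore] -/
def sndCLM (n₁ n₂ : ℕ) : Config (n₁ + n₂) →L[ℝ] Config n₂ :=
  ContinuousLinearMap.pi fun i => ContinuousLinearMap.proj (Fin.natAdd n₁ i)

/-- `fstCLM X = X ∘ castAdd`. [folklore] -/
theorem fstCLM_apply (X : Config (n₁ + n₂)) : fstCLM n₁ n₂ X = fun i => X (Fin.castAdd n₂ i) :=
  rfl

/-- `sndCLM X = X ∘ natAdd`. [folklore] -/
theorem sndCLM_apply (X : Config (n₁ + n₂)) : sndCLM n₁ n₂ X = fun i => X (Fin.natAdd n₁ i) :=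
  rfl

/-- A direction of a first-group particle projects to that direction. [folklore] -/
theorem fstCLM_single_castAdd (i : Fin n₁) (w : Space) :
    fstCLM n₁ n₂ (Pi.single (Fin.castAdd n₂ i) w) = Pi.single i w := by
  ext j k
  simp [fstCLM, Pi.single_apply, Fin.castAdd_inj]

/-- A direction of a second-group particle projects to zero on the first group. [folklore] -/
theorem fstCLM_single_natAdd (i : Fin n₂) (w : Space) :
    fstCLM n₁ n₂ (Pi.single (Fin.natAdd n₁ i) w) = 0 := by
  ext j k
  have hne : Fin.castAdd n₂ j ≠ Fin.natAdd n₁ i := by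
    intro h
    have := congrArg Fin.val h
    simp at this
    omega
  simp [fstCLM, hne]

/-- A direction of a first-group particle projects to zero on the second group. [folklore] -/
theorem sndCLM_single_castAdd (i : Fin n₁) (w : Space) :
    sndCLM n₁ n₂ (Pi.single (Fin.castAdd n₂ i) w) = 0 := by
  ext j k
  have hne : Fin.natAdd n₁ j ≠ Fin.castAdd n₂ i := by
    intro h
    have := congrArg Fin.val h
    simp at this
    omega
  simp [sndCLM, hne]

/-- A direction of a second-group particle projects to that direction. [folklore] -/
theorem sndCLM_single_natAdd (i : Fin n₂) (w : Space) :
    sndCLM n₁ n₂ (Pi.single (Fin.natAdd n₁ i) w) = Pi.single i w := by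
  ext j k
  simp [sndCLM, Pi.single_apply, Fin.natAdd_inj]

/-- **The product wave function** `(ψ₁ ⊗ ψ₂)(X) = ψ₁(x₁,…,x_{n₁}) ψ₂(x_{n₁+1},…,x_{n₁+n₂})` of two
wave functions on complementary groups of particles. [cite: Ruelle1969, §3.5 (proof of subadditivity)] -/
def prodFun (ψ₁ : Config n₁ → ℂ) (ψ₂ : Config n₂ → ℂ) (X : Config (n₁ + n₂)) : ℂ :=
  ψ₁ (fstCLM n₁ n₂ X) * ψ₂ (sndCLM n₁ n₂ X)

variable {ψ₁ : Config n₁ → ℂ} {ψ₂ : Config n₂ → ℂ}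

/-- The product of `C¹` functions is `C¹`. [folklore] -/
theorem contDiff_prodFun (h₁ : ContDiff ℝ 1 ψ₁) (h₂ : ContDiff ℝ 1 ψ₂) :
    ContDiff ℝ 1 (prodFun ψ₁ ψ₂) :=
  (h₁.comp (fstCLM n₁ n₂).contDiff).mul (h₂.comp (sndCLM n₁ n₂).contDiff)

/-- The derivative of the product (Leibniz rule and chain rule). [folklore] -/
theorem fderiv_prodFun (h₁ : Differentiable ℝ ψ₁) (h₂ : Differentiable ℝ ψ₂)
    (X : Config (n₁ + n₂)) :
    fderiv ℝ (prodFun ψ₁ ψ₂) X =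
      ψ₁ (fstCLM n₁ n₂ X) • (fderiv ℝ ψ₂ (sndCLM n₁ n₂ X)).comp (sndCLM n₁ n₂) +
        ψ₂ (sndCLM n₁ n₂ X) • (fderiv ℝ ψ₁ (fstCLM n₁ n₂ X)).comp (fstCLM n₁ n₂) := by
  have hd₁ : HasFDerivAt (fun X => ψ₁ (fstCLM n₁ n₂ X))
      ((fderiv ℝ ψ₁ (fstCLM n₁ n₂ X)).comp (fstCLM n₁ n₂)) X :=
    (h₁ _).hasFDerivAt.comp X (fstCLM n₁ n₂).hasFDerivAt
  have hd₂ : HasFDerivAt (fun X => ψ₂ (sndCLM n₁ n₂ X))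
      ((fderiv ℝ ψ₂ (sndCLM n₁ n₂ X)).comp (sndCLM n₁ n₂)) X :=
    (h₂ _).hasFDerivAt.comp X (sndCLM n₁ n₂).hasFDerivAt
  exact (hd₁.mul hd₂).fderiv

/-- `‖c z‖² = ‖c‖² ‖z‖²` in `ℝ≥0∞`. [folklore] -/
theorem ennnorm_mul_sq (c z : ℂ) :
    ((‖c * z‖₊ : ℝ≥0∞)) ^ 2 = ((‖c‖₊ : ℝ≥0∞)) ^ 2 * ((‖z‖₊ : ℝ≥0∞)) ^ 2 := by
  rw [nnnorm_mul, ENNReal.coe_mul, mul_pow]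

/-- Kinetic energy density of the first group in the product: `|∇₁(ψ₁ ⊗ ψ₂)|² = |∇ψ₁|² |ψ₂|²`.
[folklore] -/
theorem kineticOn_castAdd_prodFun (h₁ : Differentiable ℝ ψ₁) (h₂ : Differentiable ℝ ψ₂)
    (X : Config (n₁ + n₂)) :
    kineticOn (Fin.castAdd n₂) (prodFun ψ₁ ψ₂) X =
      kineticDensity ψ₁ (fstCLM n₁ n₂ X) * ((‖ψ₂ (sndCLM n₁ n₂ X)‖₊ : ℝ≥0∞)) ^ 2 := by
  unfold kineticOn kineticDensity
  rw [Finset.sum_mul]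
  refine Finset.sum_congr rfl fun i _ => ?_
  rw [Finset.sum_mul]
  refine Finset.sum_congr rfl fun k _ => ?_
  have : fderiv ℝ (prodFun ψ₁ ψ₂) X (Pi.single (Fin.castAdd n₂ i) (EuclideanSpace.single k 1)) =
      ψ₂ (sndCLM n₁ n₂ X) *
        fderiv ℝ ψ₁ (fstCLM n₁ n₂ X) (Pi.single i (EuclideanSpace.single k 1)) := by
    rw [fderiv_prodFun h₁ h₂]
    simp [sndCLM_single_castAdd, fstCLM_single_castAdd]
  rw [this, ennnorm_mul_sq, mul_comm]

/-- Kinetic energy density of the second group in the product: `|∇₂(ψ₁ ⊗ ψ₂)|² = |ψ₁|² |∇ψ₂|²`.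
[folklore] -/
theorem kineticOn_natAdd_prodFun (h₁ : Differentiable ℝ ψ₁) (h₂ : Differentiable ℝ ψ₂)
    (X : Config (n₁ + n₂)) :
    kineticOn (Fin.natAdd n₁) (prodFun ψ₁ ψ₂) X =
      ((‖ψ₁ (fstCLM n₁ n₂ X)‖₊ : ℝ≥0∞)) ^ 2 * kineticDensity ψ₂ (sndCLM n₁ n₂ X) := by
  unfold kineticOn kineticDensity
  rw [Finset.mul_sum]
  refine Finset.sum_congr rfl fun i _ => ?_
  rw [Finset.mul_sum]
  refine Finset.sum_congr rfl fun k _ => ?_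
  have : fderiv ℝ (prodFun ψ₁ ψ₂) X (Pi.single (Fin.natAdd n₁ i) (EuclideanSpace.single k 1)) =
      ψ₁ (fstCLM n₁ n₂ X) *
        fderiv ℝ ψ₂ (sndCLM n₁ n₂ X) (Pi.single i (EuclideanSpace.single k 1)) := by
    rw [fderiv_prodFun h₁ h₂]
    simp [sndCLM_single_natAdd, fstCLM_single_natAdd]
  rw [this, ennnorm_mul_sq]

/-- **Kinetic energy density of the product**: `|∇(ψ₁ ⊗ ψ₂)|² = |∇ψ₁|²|ψ₂|² + |ψ₁|²|∇ψ₂|²`.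
[folklore] -/
theorem kineticDensity_prodFun (h₁ : Differentiable ℝ ψ₁) (h₂ : Differentiable ℝ ψ₂)
    (X : Config (n₁ + n₂)) :
    kineticDensity (prodFun ψ₁ ψ₂) X =
      kineticDensity ψ₁ (fstCLM n₁ n₂ X) * ((‖ψ₂ (sndCLM n₁ n₂ X)‖₊ : ℝ≥0∞)) ^ 2 +
        ((‖ψ₁ (fstCLM n₁ n₂ X)‖₊ : ℝ≥0∞)) ^ 2 * kineticDensity ψ₂ (sndCLM n₁ n₂ X) := by
  rw [kineticDensity_eq_kineticOn_add, kineticOn_castAdd_prodFun h₁ h₂,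
    kineticOn_natAdd_prodFun h₁ h₂]

/-- **The interaction of two non-interacting groups** is the sum of the groups' interactions.
[folklore] -/
theorem interaction_eq_add_of_cross_eq_zero (v : ℝ → ℝ≥0∞) (X : Config (n₁ + n₂))
    (h : ∀ (i : Fin n₁) (j : Fin n₂), v (dist (X (Fin.castAdd n₂ i)) (X (Fin.natAdd n₁ j))) = 0) :
    interaction v X = interaction v (fstCLM n₁ n₂ X) + interaction v (sndCLM n₁ n₂ X) := by
  unfold interaction
  simp only [Finset.sum_filter, fstCLM_apply, sndCLM_apply]
  rw [Fin.sum_univ_add]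
  congr 1
  · refine Finset.sum_congr rfl fun i _ => ?_
    rw [Fin.sum_univ_add]
    have h0 : ∑ j : Fin n₂, (if Fin.castAdd n₂ i < Fin.natAdd n₁ j then
        v (dist (X (Fin.castAdd n₂ i)) (X (Fin.natAdd n₁ j))) else 0) = 0 :=
      Finset.sum_eq_zero fun j _ => by simp [h i j]
    rw [h0, add_zero]
    refine Finset.sum_congr rfl fun j _ => ?_
    simp only [(Fin.strictMono_castAdd n₂).lt_iff_lt]
  · refine Finset.sum_congr rfl fun i _ => ?_
    rw [Fin.sum_univ_add]
    have h0 : ∑ j : Fin n₁, (if Fin.natAdd n₁ i < Fin.castAdd n₂ j then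
        v (dist (X (Fin.natAdd n₁ i)) (X (Fin.castAdd n₂ j))) else 0) = 0 :=
      Finset.sum_eq_zero fun j _ => by rw [dist_comm]; simp [h j i]
    rw [h0, zero_add]
    refine Finset.sum_congr rfl fun j _ => ?_
    simp only [(Fin.strictMono_natAdd n₁).lt_iff_lt]

/-- `|ψ₁ ⊗ ψ₂|² = |ψ₁|² |ψ₂|²`. [folklore] -/
theorem ennnorm_prodFun_sq (X : Config (n₁ + n₂)) :
    ((‖prodFun ψ₁ ψ₂ X‖₊ : ℝ≥0∞)) ^ 2 =
      ((‖ψ₁ (fstCLM n₁ n₂ X)‖₊ : ℝ≥0∞)) ^ 2 * ((‖ψ₂ (sndCLM n₁ n₂ X)‖₊ : ℝ≥0∞)) ^ 2 :=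
  ennnorm_mul_sq _ _

/-- **The energy density of the product of two non-interacting groups** splits:
`|∇(ψ₁⊗ψ₂)|² + V|ψ₁⊗ψ₂|² = (|∇ψ₁|² + V₁|ψ₁|²)|ψ₂|² + |ψ₁|²(|∇ψ₂|² + V₂|ψ₂|²)` at every
configuration where (if the product does not vanish) no particle of the first group interacts
with a particle of the second. [cite: Ruelle1969, §3.5] -/
theorem energyDensity_prodFun (h₁ : Differentiable ℝ ψ₁) (h₂ : Differentiable ℝ ψ₂)
    (v : ℝ → ℝ≥0∞) (X : Config (n₁ + n₂))
    (h : prodFun ψ₁ ψ₂ X ≠ 0 →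
      ∀ (i : Fin n₁) (j : Fin n₂), v (dist (X (Fin.castAdd n₂ i)) (X (Fin.natAdd n₁ j))) = 0) :
    kineticDensity (prodFun ψ₁ ψ₂) X + interaction v X * ((‖prodFun ψ₁ ψ₂ X‖₊ : ℝ≥0∞)) ^ 2 =
      (kineticDensity ψ₁ (fstCLM n₁ n₂ X) +
          interaction v (fstCLM n₁ n₂ X) * ((‖ψ₁ (fstCLM n₁ n₂ X)‖₊ : ℝ≥0∞)) ^ 2) *
          ((‖ψ₂ (sndCLM n₁ n₂ X)‖₊ : ℝ≥0∞)) ^ 2 +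
        ((‖ψ₁ (fstCLM n₁ n₂ X)‖₊ : ℝ≥0∞)) ^ 2 *
          (kineticDensity ψ₂ (sndCLM n₁ n₂ X) +
            interaction v (sndCLM n₁ n₂ X) * ((‖ψ₂ (sndCLM n₁ n₂ X)‖₊ : ℝ≥0∞)) ^ 2) := by
  rw [kineticDensity_prodFun h₁ h₂]
  by_cases h0 : prodFun ψ₁ ψ₂ X = 0
  · have hsq : ((‖ψ₁ (fstCLM n₁ n₂ X)‖₊ : ℝ≥0∞)) ^ 2 * ((‖ψ₂ (sndCLM n₁ n₂ X)‖₊ : ℝ≥0∞)) ^ 2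
        = 0 := by rw [← ennnorm_prodFun_sq, h0]; simp
    calc _ = kineticDensity ψ₁ (fstCLM n₁ n₂ X) * ((‖ψ₂ (sndCLM n₁ n₂ X)‖₊ : ℝ≥0∞)) ^ 2 +
          ((‖ψ₁ (fstCLM n₁ n₂ X)‖₊ : ℝ≥0∞)) ^ 2 * kineticDensity ψ₂ (sndCLM n₁ n₂ X) := by
          rw [h0]; simp
      _ = _ := by
          rw [add_mul, mul_add, mul_assoc, hsq, mul_comm _ (interaction v (sndCLM n₁ n₂ X) * _),
            mul_assoc, mul_comm (((‖ψ₂ (sndCLM n₁ n₂ X)‖₊ : ℝ≥0∞)) ^ 2), hsq]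
          simp
  · rw [interaction_eq_add_of_cross_eq_zero v X (h h0), ennnorm_prodFun_sq]
    ring

/-- **The energy of the product of two non-interacting groups**:
`𝓔[ψ₁ ⊗ ψ₂] = 𝓔[ψ₁] ‖ψ₂‖² + ‖ψ₁‖² 𝓔[ψ₂]`. [cite: Ruelle1969, §3.5] -/
theorem lintegral_energyDensity_prodFun (h₁ : ContDiff ℝ 1 ψ₁) (h₂ : ContDiff ℝ 1 ψ₂)
    {v : ℝ → ℝ≥0∞} (hv : Measurable v)
    (h : ∀ X : Config (n₁ + n₂), prodFun ψ₁ ψ₂ X ≠ 0 →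
      ∀ (i : Fin n₁) (j : Fin n₂), v (dist (X (Fin.castAdd n₂ i)) (X (Fin.natAdd n₁ j))) = 0) :
    ∫⁻ X, kineticDensity (prodFun ψ₁ ψ₂) X +
        interaction v X * ((‖prodFun ψ₁ ψ₂ X‖₊ : ℝ≥0∞)) ^ 2 =
      (∫⁻ Y, kineticDensity ψ₁ Y + interaction v Y * ((‖ψ₁ Y‖₊ : ℝ≥0∞)) ^ 2) *
          (∫⁻ Z, ((‖ψ₂ Z‖₊ : ℝ≥0∞)) ^ 2) +
        (∫⁻ Y, ((‖ψ₁ Y‖₊ : ℝ≥0∞)) ^ 2) *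
          ∫⁻ Z, kineticDensity ψ₂ Z + interaction v Z * ((‖ψ₂ Z‖₊ : ℝ≥0∞)) ^ 2 := by
  have hd₁ := h₁.differentiable one_ne_zero
  have hd₂ := h₂.differentiable one_ne_zero
  simp only [energyDensity_prodFun hd₁ hd₂ v _ (h _), fstCLM_apply, sndCLM_apply]
  have hm₁ : Measurable fun Y => kineticDensity ψ₁ Y + interaction v Y * ((‖ψ₁ Y‖₊ : ℝ≥0∞)) ^ 2 :=
    (measurable_kineticDensity h₁).add ((measurable_interaction hv).mul
      (measurable_normSq h₁.continuous))
  have hm₂ : Measurable fun Z => kineticDensity ψ₂ Z + interaction v Z * ((‖ψ₂ Z‖₊ : ℝ≥0∞)) ^ 2 :=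
    (measurable_kineticDensity h₂).add ((measurable_interaction hv).mul
      (measurable_normSq h₂.continuous))
  have hn₁ : Measurable fun Y => ((‖ψ₁ Y‖₊ : ℝ≥0∞)) ^ 2 := measurable_normSq h₁.continuous
  have hn₂ : Measurable fun Z => ((‖ψ₂ Z‖₊ : ℝ≥0∞)) ^ 2 := measurable_normSq h₂.continuous
  have hc : Measurable fun X : Config (n₁ + n₂) => fun i : Fin n₁ => X (Fin.castAdd n₂ i) :=
    measurable_pi_lambda _ fun i => measurable_pi_apply (Fin.castAdd n₂ i)
  have hd : Measurable fun X : Config (n₁ + n₂) => fun i : Fin n₂ => X (Fin.natAdd n₁ i) :=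
    measurable_pi_lambda _ fun i => measurable_pi_apply (Fin.natAdd n₁ i)
  have hA : Measurable fun X : Config (n₁ + n₂) =>
      (kineticDensity ψ₁ (fun i => X (Fin.castAdd n₂ i)) +
          interaction v (fun i => X (Fin.castAdd n₂ i)) *
            ((‖ψ₁ fun i => X (Fin.castAdd n₂ i)‖₊ : ℝ≥0∞)) ^ 2) *
        ((‖ψ₂ fun i => X (Fin.natAdd n₁ i)‖₊ : ℝ≥0∞)) ^ 2 :=
    (hm₁.comp hc).mul (hn₂.comp hd)
  rw [lintegral_add_left hA, lintegral_mul_split hm₁ hn₂, lintegral_mul_split hn₁ hm₂]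

/-- **The norm of the product**: `‖ψ₁ ⊗ ψ₂‖² = ‖ψ₁‖² ‖ψ₂‖²`. [folklore] -/
theorem lintegral_ennnorm_prodFun_sq (h₁ : Continuous ψ₁) (h₂ : Continuous ψ₂) :
    ∫⁻ X, ((‖prodFun ψ₁ ψ₂ X‖₊ : ℝ≥0∞)) ^ 2 =
      (∫⁻ Y, ((‖ψ₁ Y‖₊ : ℝ≥0∞)) ^ 2) * ∫⁻ Z, ((‖ψ₂ Z‖₊ : ℝ≥0∞)) ^ 2 := by
  simp only [ennnorm_prodFun_sq, fstCLM_apply, sndCLM_apply]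
  exact lintegral_mul_split (measurable_normSq h₁) (measurable_normSq h₂)

end Product

end Literature.MathematicalPhysics.QuantumManyBody.BoseGas

end
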